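import Mathlib.GroupTheory.PGroup
import Literature.NumberTheory.EllipticCurves.TwoIsogenySelmerGroup
import Literature.NumberTheory.EllipticCurves.TwoIsogenyDescentAlpha
import HarnessLib

/-!
# The explicit `2`-isogeny Selmer sets are groups of exponent `2`: `#S = 2^{dim}`
# (Silverman–Tate, *Rational Points on Elliptic Curves*, §3.5–3.6; Silverman, *AEC*, Prop. X.4.9)

Sibling proof file of `Literature.NumberTheory.EllipticCurves.TwoIsogenySelmerGroup`, which defines,
for `a, b ∈ ℤ`, the finite set `twoIsogenySelmerGroup a b` of squarefree `d ∣ b` whose homogeneous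
space `w² = d u⁴ + a u²z² + (b/d) z⁴` (`twoIsogenyQuartic a d (b/d)`) has a point over `ℝ` and over
every `ℚ_p`, and its "dimension" `twoIsogenySelmerRank a b = log₂ #twoIsogenySelmerGroup a b`; its
module docstring announces that the group structure "is to be PROVED in a sibling file via the
homomorphism `α`, not vendored". This is that file. Everything here is proved; there are no new
definitions and no named facts.

The input is the homomorphism `α : E(F) → F*/F*²`, `(x, y) ↦ [x]`, `T ↦ [b]`
(`WeierstrassCurve.xSqClass`, file `TwoIsogenyDescentAlpha`; Silverman–Tate §3.5) of
`E = E_{a,b} : y² = x³ + a x² + b x` over a field `F`, together with the solubility criterion of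
§3.6 (`WeierstrassCurve.exists_sq_eq_quartic_iff`): for `d d' = b` the curve
`w² = d u⁴ + a u²z² + d' z⁴` has an `F`-point iff `[d] ∈ α(E(F))`. Consequently:

* `isSoluble_map_twoIsogenyQuartic_iff` — over a field `F ⊇ ℚ` in which `E_{a,b}` is elliptic,
  `twoIsogenyQuartic a d d'` (`d d' = b`) is `F`-soluble iff `[d] ∈ α(E_{a,b}(F))`; hence
  (`mem_twoIsogenySelmerGroup_iff_sqClass`) **`S(a, b) = {d : [d]_v ∈ α(E(ℚ_v)) for all places v}`**,
  the description of the Selmer group as the classes lying in the image of the local Kummer map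
  `α_v = δ_v` at every place (Silverman, *AEC*, X.4.9: "`δ(ψ(P)) ≡ d`"; Silverman–Tate §3.6).
* `exists_mem_twoIsogenySelmerGroup_of_mul_mem` — **`S(a, b)` is closed under multiplication modulo
  squares**: for `d₁, d₂ ∈ S(a, b)` the squarefree kernel `d₃` of `d₁d₂` (`d₁ d₂ = m² d₃`,
  `m = gcd(d₁, d₂)`) lies in `S(a, b)` — because each `α(E(ℚ_v))` is a subgroup of `ℚ_v*/ℚ_v*²`
  (`WeierstrassCurve.mul_mem_range_xSqClass`, i.e. `α` is a homomorphism, Silverman–Tate §3.5).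
* `exists_card_twoIsogenySelmerGroup_eq_two_pow`, `two_pow_twoIsogenySelmerRank_eq_card` (and the
  primed versions for the descent on the divisors of `a² - 4b`) — **`#S(a, b) = 2^{dim}`**: the
  square-class map `d ↦ [d] ∈ ℚ*/ℚ*²` is injective on squarefree integers
  (`eq_of_squarefree_of_mul_eq_sq`) and carries `S(a, b)` onto a finite subgroup of the group
  `ℚ*/ℚ*²` of exponent `2`, whose order is a power of `2` (`IsPGroup.iff_card`). This is the
  statement "`S^{(φ)}(E/ℚ)` is a subgroup of `ℚ(S, 2)`", *AEC* X.4.9, for the explicit sets, and it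
  makes `twoIsogenySelmerRank a b` the genuine `𝔽₂`-dimension appearing in
  `cassels_selmerCorank_two_parity` and `twoIsogeny_mordellWeilRank_add_two_le`.

## References

* J. H. Silverman, J. T. Tate, *Rational Points on Elliptic Curves*, 2nd ed. (2015), §3.5 (the
  homomorphism `α`), §3.6 (the equations `N² = b₁M⁴ + aM²e² + b₂e⁴`). [SilvermanTate2015]
* J. H. Silverman, *The Arithmetic of Elliptic Curves*, 2nd ed., GTM 106 (2009), Prop. X.4.9
  (`S^{(φ)}(E/K)` as a subgroup of `K(S, 2)` cut out by local solubility). [SilvermanAEC2009]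

## Design

Theorems only; `open scoped Classical` as in the sibling files. The curve over a field `F` is the
literal `(⟨0, a, 0, b, 0⟩ : WeierstrassCurve F)` (instances `isTwoTorsionNF_mk` and, for
`char F = 0` and `b (a² - 4b) ≠ 0`, `isElliptic_mk_of_ne_zero` below).
-/

noncomputable section

open scoped Classical

namespace Literature.NumberTheory.EllipticCurves

open WeierstrassCurve
open WeierstrassCurve.Affine (SqUnits sqClass sqClass_mul sqClass_sq sqClass_eq_one_iff
  sqClass_eq_mul_of_mul_mul_eq_sq)

/-! ## Squarefree integers and square classes -/

section IntArith

/-- **The product of two squarefree integers modulo squares**: for squarefree `d₁, d₂` there are a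
squarefree `d₃` and `m ≠ 0` with `d₁ d₂ = m² d₃` (`m = gcd(d₁, d₂)`, `d₃ = d₁d₂/m²`), and `d₃`
divides every common multiple of `d₁, d₂`. [folklore] -/
theorem exists_squarefree_mul_eq_sq_mul {d₁ d₂ : ℤ} (h₁ : Squarefree d₁) (h₂ : Squarefree d₂) :
    ∃ d₃ m : ℤ, Squarefree d₃ ∧ m ≠ 0 ∧ d₁ * d₂ = m ^ 2 * d₃ ∧
      ∀ b : ℤ, d₁ ∣ b → d₂ ∣ b → d₃ ∣ b := by
  obtain ⟨g, e₁, e₂, hg, hcop, he₁, he₂⟩ :=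
    Int.exists_gcd_one' (Int.gcd_pos_of_ne_zero_left d₂ h₁.ne_zero)
  have hcop' : IsCoprime e₁ e₂ := Int.isCoprime_iff_gcd_eq_one.mpr hcop
  have hd₁ : e₁ ∣ d₁ := ⟨g, he₁⟩
  have hd₂ : e₂ ∣ d₂ := ⟨g, he₂⟩
  refine ⟨e₁ * e₂, g, ?_, by exact_mod_cast hg.ne', by rw [he₁, he₂]; ring, fun b hb₁ hb₂ =>
    hcop'.mul_dvd (hd₁.trans hb₁) (hd₂.trans hb₂)⟩
  rw [squarefree_mul_iff]
  exact ⟨hcop'.isRelPrime, h₁.squarefree_of_dvd hd₁, h₂.squarefree_of_dvd hd₂⟩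

/-- If `d₁` is squarefree and `d₁ d₂` is a square, every prime factor of `d₁` divides `d₂`.
[folklore] -/
theorem dvd_of_squarefree_of_mul_eq_sq {d₁ d₂ m : ℤ} (h₁ : Squarefree d₁) (h : d₁ * d₂ = m ^ 2)
    {p : ℤ} (hp : Prime p) (hpd : p ∣ d₁) : p ∣ d₂ := by
  obtain ⟨c, rfl⟩ := hpd
  obtain ⟨k, rfl⟩ : p ∣ m := hp.dvd_of_dvd_pow (n := 2) ⟨c * d₂, by rw [← h]; ring⟩
  have h' : c * d₂ = p * k ^ 2 :=
    mul_left_cancel₀ hp.ne_zero (by rw [← mul_assoc, h]; ring)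
  rcases hp.dvd_or_dvd ⟨k ^ 2, h'⟩ with hc | hd
  · obtain ⟨c', rfl⟩ := hc
    exact absurd (h₁ p ⟨c', by ring⟩) hp.not_unit
  · exact hd

/-- **Squarefree integers are determined by their square class**: if `d₁, d₂` are squarefree and
`d₁ d₂` is a square then `d₁ = d₂`. [folklore] -/
theorem eq_of_squarefree_of_mul_eq_sq {d₁ d₂ m : ℤ} (h₁ : Squarefree d₁) (h₂ : Squarefree d₂)
    (h : d₁ * d₂ = m ^ 2) : d₁ = d₂ := by
  have hm : m ≠ 0 := by
    rintro rfl
    rw [zero_pow two_ne_zero, mul_eq_zero] at h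
    exact h.elim h₁.ne_zero h₂.ne_zero
  have hpos : 0 < d₁ * d₂ := by rw [h]; positivity
  refine eq_of_squarefree_of_primeFactors_eq h₁ h₂ ?_ ?_
  · rcases pos_and_pos_or_neg_and_neg_of_mul_pos hpos with ⟨ha, hb⟩ | ⟨ha, hb⟩
    · constructor <;> intro h' <;> linarith
    · exact ⟨fun _ => hb, fun _ => ha⟩
  · ext p
    simp only [Nat.mem_primeFactors, ne_eq, Int.natAbs_eq_zero, h₁.ne_zero, h₂.ne_zero,
      not_false_eq_true, and_true, and_congr_right_iff]
    intro hp
    have hp' : Prime (p : ℤ) := Nat.prime_iff_prime_int.mp hp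
    rw [← Int.natCast_dvd, ← Int.natCast_dvd]
    exact ⟨dvd_of_squarefree_of_mul_eq_sq h₁ h hp',
      dvd_of_squarefree_of_mul_eq_sq h₂ (by rw [mul_comm, h]) hp'⟩

variable {F : Type*} [Field F] [CharZero F]

/-- If `d₁ d₂ = m² d₃` with `d₁ d₂ ≠ 0` then `[d₃] = [d₁][d₂]` in `F*/F*²` for any field `F ⊇ ℚ`.
[folklore] -/
theorem sqClass_intCast_eq_mul {d₁ d₂ d₃ m : ℤ} (h₁ : d₁ ≠ 0) (h₂ : d₂ ≠ 0)
    (h : d₁ * d₂ = m ^ 2 * d₃) :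
    sqClass (d₃ : F) = sqClass (d₁ : F) * sqClass (d₂ : F) := by
  have h₃ : d₃ ≠ 0 := by
    rintro rfl
    rw [mul_zero, mul_eq_zero] at h
    exact h.elim h₁ h₂
  refine sqClass_eq_mul_of_mul_mul_eq_sq (z := (m : F) * d₃) (by exact_mod_cast h₁)
    (by exact_mod_cast h₂) (by exact_mod_cast h₃) ?_
  have key : d₁ * d₂ * d₃ = (m * d₃) ^ 2 := by rw [h]; ring
  exact_mod_cast key

end IntArith

/-! ## Over a field: solubility of the homogeneous space and the image of `α` -/

section Field

variable {F : Type*} [Field F]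

/-- `E_{a,b} : y² = x³ + a x² + b x` is an elliptic curve over a field of characteristic `0` when
`b (a² - 4b) ≠ 0` (`Δ = 16 b² (a² - 4b)`, Silverman, *AEC*, X.4.9). [folklore] -/
theorem isElliptic_mk_of_ne_zero [CharZero F] {a b : ℤ} (hab : b * (a ^ 2 - 4 * b) ≠ 0) :
    (⟨0, (a : F), 0, (b : F), 0⟩ : WeierstrassCurve F).IsElliptic := by
  refine ⟨isUnit_iff_ne_zero.mpr ?_⟩
  rw [Δ_of_isTwoTorsionNF]
  have hb : b ≠ 0 := left_ne_zero_of_mul hab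
  have h2 : a ^ 2 - 4 * b ≠ 0 := right_ne_zero_of_mul hab
  have key : (16 : ℤ) * b ^ 2 * (a ^ 2 - 4 * b) ≠ 0 :=
    mul_ne_zero (mul_ne_zero (by norm_num) (pow_ne_zero 2 hb)) h2
  show (16 : F) * (b : F) ^ 2 * ((a : F) ^ 2 - 4 * (b : F)) ≠ 0
  exact_mod_cast key

/-- **Solubility over `F` ⟺ `[d] ∈ α(E(F))`** (Silverman–Tate §3.6, for the tree's
`twoIsogenyQuartic`): over a field `F` in which `E_{a,b}` is elliptic, for `d d' = b` the curve
`w² = d u⁴ + a u²z² + d' z⁴` has an `F`-point (`BinaryQuartic.IsSoluble`) iff the square class of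
`d` lies in the image of `α : E_{a,b}(F) → F*/F*²`. [cite: SilvermanTate2015, §3.6] -/
theorem isSoluble_map_twoIsogenyQuartic_iff {a b d d' : ℤ} (hdd : d * d' = b)
    [(⟨0, (a : F), 0, (b : F), 0⟩ : WeierstrassCurve F).IsElliptic] :
    ((twoIsogenyQuartic a d d').map (Int.castRingHom F)).IsSoluble ↔
      sqClass (d : F) ∈ Set.range (⟨0, (a : F), 0, (b : F), 0⟩ : WeierstrassCurve F).xSqClass := by
  have key := exists_sq_eq_quartic_iff (W := (⟨0, (a : F), 0, (b : F), 0⟩ : WeierstrassCurve F))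
    (d := (d : F)) (d' := (d' : F)) (by show (d : F) * d' = (b : F); rw [← hdd, Int.cast_mul])
  rw [← key]
  constructor
  · rintro ⟨u, z, w, h0, h⟩
    exact ⟨u, z, w, h0,
      (by simpa using h : w ^ 2 = (d : F) * u ^ 4 + (a : F) * u ^ 2 * z ^ 2 + (d' : F) * z ^ 4)⟩
  · rintro ⟨u, z, w, h0, h⟩
    refine ⟨u, z, w, h0, ?_⟩
    have h' : w ^ 2 = (d : F) * u ^ 4 + (a : F) * u ^ 2 * z ^ 2 + (d' : F) * z ^ 4 := h
    simpa using h'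

/-- **The image of `α` is a group, on the level of quartics**: over a field `F ⊇ ℚ` with
`b (a² - 4b) ≠ 0`, if `d₁, d₂, d₃ ∣ b` with `d₁ d₂ = m² d₃` and the homogeneous spaces of `d₁` and
`d₂` have `F`-points, so does that of `d₃` (`[d₃] = [d₁][d₂] ∈ α(E(F))`, `α(E(F))` being a subgroup;
Silverman–Tate §3.5–3.6). [cite: SilvermanTate2015, §3.5 (α is a homomorphism)] -/
theorem isSoluble_map_twoIsogenyQuartic_of_mul_eq [CharZero F] {a b d₁ d₂ d₃ m : ℤ}
    (hab : b * (a ^ 2 - 4 * b) ≠ 0) (hd₁ : d₁ ∣ b) (hd₂ : d₂ ∣ b) (hd₃ : d₃ ∣ b)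
    (hm : d₁ * d₂ = m ^ 2 * d₃)
    (h₁ : ((twoIsogenyQuartic a d₁ (b / d₁)).map (Int.castRingHom F)).IsSoluble)
    (h₂ : ((twoIsogenyQuartic a d₂ (b / d₂)).map (Int.castRingHom F)).IsSoluble) :
    ((twoIsogenyQuartic a d₃ (b / d₃)).map (Int.castRingHom F)).IsSoluble := by
  have hb : b ≠ 0 := left_ne_zero_of_mul hab
  haveI := isElliptic_mk_of_ne_zero (F := F) hab
  rw [isSoluble_map_twoIsogenyQuartic_iff (Int.mul_ediv_cancel' hd₁)] at h₁
  rw [isSoluble_map_twoIsogenyQuartic_iff (Int.mul_ediv_cancel' hd₂)] at h₂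
  rw [isSoluble_map_twoIsogenyQuartic_iff (Int.mul_ediv_cancel' hd₃),
    sqClass_intCast_eq_mul (ne_zero_of_dvd_ne_zero hb hd₁) (ne_zero_of_dvd_ne_zero hb hd₂) hm]
  exact mul_mem_range_xSqClass _ h₁ h₂

end Field

/-! ## The Selmer sets: local images, group structure, `#S = 2^{dim}` -/

section Selmer

variable {a b d : ℤ}

/-- **`S(a, b)` is cut out by the local images of `α`**: `d ∈ S(a, b)` iff `d` is a squarefree
divisor of `b` whose square class lies in `α(E_{a,b}(ℝ))` and in `α(E_{a,b}(ℚ_p))` for every prime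
`p` — the Selmer group as the classes that are everywhere locally in the image of the Kummer map
`δ_v = α_v` (Silverman, *AEC*, Prop. X.4.9 with "`δ(ψ(P)) ≡ d`"; Silverman–Tate §3.6).
[cite: SilvermanAEC2009, Prop. X.4.9] -/
theorem mem_twoIsogenySelmerGroup_iff_sqClass (hab : b * (a ^ 2 - 4 * b) ≠ 0) :
    d ∈ twoIsogenySelmerGroup a b ↔ Squarefree d ∧ d ∣ b ∧
      sqClass (d : ℝ) ∈ Set.range (⟨0, (a : ℝ), 0, (b : ℝ), 0⟩ : WeierstrassCurve ℝ).xSqClass ∧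
      ∀ (p : ℕ) [Fact p.Prime], sqClass (d : ℚ_[p]) ∈
        Set.range (⟨0, (a : ℚ_[p]), 0, (b : ℚ_[p]), 0⟩ : WeierstrassCurve ℚ_[p]).xSqClass := by
  have hb : b ≠ 0 := left_ne_zero_of_mul hab
  haveI := isElliptic_mk_of_ne_zero (F := ℝ) hab
  haveI : ∀ (p : ℕ) [Fact p.Prime], (⟨0, (a : ℚ_[p]), 0, (b : ℚ_[p]), 0⟩ : WeierstrassCurve ℚ_[p]).IsElliptic :=
    fun p _ => isElliptic_mk_of_ne_zero hab
  rw [mem_twoIsogenySelmerGroup_iff hb, and_congr_right_iff, and_congr_right_iff]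
  intro _ hdb
  rw [BinaryQuartic.IsLocallySoluble, isSoluble_map_twoIsogenyQuartic_iff (Int.mul_ediv_cancel' hdb)]
  refine and_congr_right fun _ => forall_congr' fun p => forall_congr' fun _ => ?_
  rw [isSoluble_map_twoIsogenyQuartic_iff (Int.mul_ediv_cancel' hdb)]

/-- **`S(a, b)` is closed under multiplication modulo squares** (`b (a² - 4b) ≠ 0`): for
`d₁, d₂ ∈ S(a, b)` there is `d₃ ∈ S(a, b)` with `d₁ d₂ = m² d₃`, `m ≠ 0` (namely the squarefree
kernel of `d₁ d₂`): the classes `[d₁]_v, [d₂]_v` lie in the subgroup `α(E(ℚ_v))` at every place `v`,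
hence so does `[d₃]_v = [d₁]_v [d₂]_v` — "`S^{(φ)}(E/ℚ)` is a subgroup of `ℚ(S, 2)`"
(Silverman, *AEC*, X.4.9). [cite: SilvermanAEC2009, Prop. X.4.9] -/
theorem exists_mem_twoIsogenySelmerGroup_of_mul_mem (hab : b * (a ^ 2 - 4 * b) ≠ 0) {d₁ d₂ : ℤ}
    (h₁ : d₁ ∈ twoIsogenySelmerGroup a b) (h₂ : d₂ ∈ twoIsogenySelmerGroup a b) :
    ∃ d₃ ∈ twoIsogenySelmerGroup a b, ∃ m : ℤ, m ≠ 0 ∧ d₁ * d₂ = m ^ 2 * d₃ := by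
  have hb : b ≠ 0 := left_ne_zero_of_mul hab
  rw [mem_twoIsogenySelmerGroup_iff hb] at h₁ h₂
  obtain ⟨hsq₁, hdvd₁, hloc₁⟩ := h₁
  obtain ⟨hsq₂, hdvd₂, hloc₂⟩ := h₂
  obtain ⟨d₃, m, hsq₃, hm0, hm, hdvd⟩ := exists_squarefree_mul_eq_sq_mul hsq₁ hsq₂
  have hdvd₃ : d₃ ∣ b := hdvd b hdvd₁ hdvd₂
  refine ⟨d₃, ?_, m, hm0, hm⟩
  rw [mem_twoIsogenySelmerGroup_iff hb]
  exact ⟨hsq₃, hdvd₃,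
    isSoluble_map_twoIsogenyQuartic_of_mul_eq hab hdvd₁ hdvd₂ hdvd₃ hm hloc₁.1 hloc₂.1,
    fun p _ => isSoluble_map_twoIsogenyQuartic_of_mul_eq hab hdvd₁ hdvd₂ hdvd₃ hm (hloc₁.2 p)
      (hloc₂.2 p)⟩

/-- **`#S(a, b)` is a power of `2`** (`b (a² - 4b) ≠ 0`): `d ↦ [d] ∈ ℚ*/ℚ*²` is injective on the
squarefree integers and maps `S(a, b)` onto a finite subgroup of the exponent-`2` group `ℚ*/ℚ*²`
(closed under multiplication by `exists_mem_twoIsogenySelmerGroup_of_mul_mem`, contains `[1]`,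
`x⁻¹ = x`), a finite `2`-group. (Silverman, *AEC*, X.4.9: `S^{(φ)}` is a finite group of exponent
`2`.) [cite: SilvermanAEC2009, Prop. X.4.9] -/
theorem exists_card_twoIsogenySelmerGroup_eq_two_pow (hab : b * (a ^ 2 - 4 * b) ≠ 0) :
    ∃ k : ℕ, (twoIsogenySelmerGroup a b).card = 2 ^ k := by
  have hb : b ≠ 0 := left_ne_zero_of_mul hab
  set S := twoIsogenySelmerGroup a b with hS
  set ι : ℤ → SqUnits ℚ := fun d => sqClass (d : ℚ) with hι
  -- `ι` is injective on `S`
  have hinj : Set.InjOn ι (S : Set ℤ) := by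
    intro d₁ hd₁ d₂ hd₂ he
    have hsq₁ := squarefree_of_mem_twoIsogenySelmerGroup (Finset.mem_coe.mp hd₁)
    have hsq₂ := squarefree_of_mem_twoIsogenySelmerGroup (Finset.mem_coe.mp hd₂)
    have h0₁ : (d₁ : ℚ) ≠ 0 := by exact_mod_cast hsq₁.ne_zero
    have h0₂ : (d₂ : ℚ) ≠ 0 := by exact_mod_cast hsq₂.ne_zero
    have h1 : sqClass ((d₁ : ℚ) * d₂) = 1 := by
      simp only [hι] at he
      rw [sqClass_mul h0₁ h0₂, he, Affine.SqUnits.mul_self]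
    obtain ⟨u, hu⟩ := (sqClass_eq_one_iff (mul_ne_zero h0₁ h0₂)).mp h1
    obtain ⟨m, hm⟩ : IsSquare (d₁ * d₂) := by
      rw [← Rat.isSquare_intCast_iff]
      exact ⟨u, by push_cast; rw [hu, pow_two]⟩
    exact eq_of_squarefree_of_mul_eq_sq hsq₁ hsq₂ (m := m) (by rw [hm, pow_two])
  -- the image is a subgroup of `ℚ*/ℚ*²`
  let H : Subgroup (SqUnits ℚ) :=
    { carrier := ↑(S.image ι)
      mul_mem' := by
        intro x y hx hy
        rw [Finset.mem_coe, Finset.mem_image] at hx hy ⊢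
        obtain ⟨d₁, hd₁, rfl⟩ := hx
        obtain ⟨d₂, hd₂, rfl⟩ := hy
        obtain ⟨d₃, hd₃, m, -, hm⟩ := exists_mem_twoIsogenySelmerGroup_of_mul_mem hab hd₁ hd₂
        refine ⟨d₃, hd₃, ?_⟩
        simp only [hι]
        rw [sqClass_intCast_eq_mul (ne_zero_of_mem_twoIsogenySelmerGroup hd₁)
          (ne_zero_of_mem_twoIsogenySelmerGroup hd₂) hm]
      one_mem' := by
        rw [Finset.mem_coe, Finset.mem_image]
        refine ⟨1, one_mem_twoIsogenySelmerGroup a hb, ?_⟩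
        simp only [hι, Int.cast_one]
        exact (sqClass_eq_one_iff one_ne_zero).mpr ⟨1, (one_pow 2).symm⟩
      inv_mem' := by
        intro x hx
        rwa [Affine.SqUnits.inv_eq_self] }
  haveI : Finite H := (S.image ι).finite_toSet.to_subtype
  -- of exponent `2`, hence a `2`-group
  have hP : IsPGroup 2 H := fun g => ⟨1, Subtype.ext (by
    rw [pow_one, pow_two, Subgroup.coe_mul, Subgroup.coe_one]
    exact Affine.SqUnits.mul_self _)⟩
  obtain ⟨k, hk⟩ := IsPGroup.iff_card.mp hP
  refine ⟨k, ?_⟩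
  rw [← Finset.card_image_of_injOn hinj, ← Nat.card_eq_finsetCard]
  exact hk

/-- **`2^{dim₂ S(a, b)} = #S(a, b)`**: the "dimension" `twoIsogenySelmerRank a b = log₂ #S(a, b)` is
exact (`b (a² - 4b) ≠ 0`). [folklore] -/
theorem two_pow_twoIsogenySelmerRank_eq_card (hab : b * (a ^ 2 - 4 * b) ≠ 0) :
    2 ^ twoIsogenySelmerRank a b = (twoIsogenySelmerGroup a b).card := by
  obtain ⟨k, hk⟩ := exists_card_twoIsogenySelmerGroup_eq_two_pow hab
  rw [twoIsogenySelmerRank, hk, Nat.log_pow one_lt_two]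

/-- The nonvanishing condition is symmetric under `(a, b) ↦ (-2a, a² - 4b)` (passing to the
isogenous curve `E'`): `(a² - 4b) ((-2a)² - 4(a² - 4b)) = 16 b (a² - 4b)`. [folklore] -/
theorem twoIsogenyCodomain_ne_zero (hab : b * (a ^ 2 - 4 * b) ≠ 0) :
    (a ^ 2 - 4 * b) * ((-2 * a) ^ 2 - 4 * (a ^ 2 - 4 * b)) ≠ 0 := by
  have hb : b ≠ 0 := left_ne_zero_of_mul hab
  have h2 : a ^ 2 - 4 * b ≠ 0 := right_ne_zero_of_mul hab
  have key : (a ^ 2 - 4 * b) * ((-2 * a) ^ 2 - 4 * (a ^ 2 - 4 * b)) = (a ^ 2 - 4 * b) * (16 * b) := by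
    ring
  rw [key]
  exact mul_ne_zero h2 (mul_ne_zero (by norm_num) hb)

/-- **`#S'(a, b)` is a power of `2`** (descent on the divisors of `a² - 4b`). [cite: SilvermanAEC2009, Prop. X.4.9] -/
theorem exists_card_twoIsogenySelmerGroup'_eq_two_pow (hab : b * (a ^ 2 - 4 * b) ≠ 0) :
    ∃ k : ℕ, (twoIsogenySelmerGroup' a b).card = 2 ^ k :=
  exists_card_twoIsogenySelmerGroup_eq_two_pow (twoIsogenyCodomain_ne_zero hab)

/-- **`2^{dim₂ S'(a, b)} = #S'(a, b)`** (descent on the divisors of `a² - 4b`). [folklore] -/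
theorem two_pow_twoIsogenySelmerRank'_eq_card (hab : b * (a ^ 2 - 4 * b) ≠ 0) :
    2 ^ twoIsogenySelmerRank' a b = (twoIsogenySelmerGroup' a b).card :=
  two_pow_twoIsogenySelmerRank_eq_card (twoIsogenyCodomain_ne_zero hab)

end Selmer

end Literature.NumberTheory.EllipticCurves
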